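import Summits.ABC.ABC.Theses.CongruentialReceptacle
import Summits.ABC.ABC.Theorems.CongruentialReceptacleAssembly
import Literature.NumberTheory.DiophantineGeometry.PastenSubexpTheorem14
import HarnessLib

/-!
# Route CongruentialReceptacle — item `QuarterWindowGivesCrux` (stmt-ABC-15117)

The crux `BalancedFreySzpiro` of route CongruentialReceptacle quantifies over every balance `κ > 0`:
for abc triples with `κc ≤ a`, `κc ≤ b` it asks `(abc)² ≤ C(κ, ε) · rad(abc)^(6+ε)`. This file proves that
the single instance `κ = 1/4` already implies the whole crux (the quantifier over `κ` is spurious):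

`quarterWindowGivesCrux_proof : SzpiroOnWindow(1/4) → BalancedFreySzpiro`.

## Proof (balance-window descent, idea card `balance-window-descent` of crux stmt-ABC-1723)

Work in the logarithmic abc currency on a window: `W(κ)` := for every `ε > 0` there is `K ≥ 0` with
`log c ≤ K + (1+ε) · log rad(abc)` for all abc triples with `κc ≤ a`, `κc ≤ b`.

* currency in (`log_window_of_szpiro_window`): on the window `κ = 1/4` one has `(1/4)⁴ c⁶ ≤ (abc)²`
  (`balanced_pow_six_le`), so the hypothesis gives `W(1/4)`;
* one descent step (`log_descent_core`): if `W(κ₁)` with `κ₁ ≤ 1/4` and `(2/3)κ₁ c ≤ a < κ₁ c`, the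
  *squaring split* `(a(a+2b), b², c²)` is again an abc triple (`split_isABCTriple`:
  `a(a+2b) + b² = (a+b)² = c²`), it lies in the window `κ₁` (`a(a+2b) ≥ (2/3)κ₁c · (7/4)c ≥ κ₁c²`,
  `b² ≥ (3c/4)² ≥ κ₁c²`), and its radical is at most `(a+2b) · rad(abc) ≤ 2c · rad(abc)` (`rad_split_le`).
  Hence `2 log c ≤ K' + (1+ε')(log 2 + log c + log rad)`, i.e.
  `log c ≤ (K' + (1+ε') log 2)/(1−ε') + ((1+ε')/(1−ε')) log rad`; with `ε' = ε/(2+ε)` the slope is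
  exactly `1 + ε`. Together with the symmetric case (`IsABCTriple.swap`, `rad_swap`) this gives
  `W(κ₁) → W((2/3)κ₁)`;
* iterate along `κₙ = ¼(2/3)ⁿ → 0` and use monotonicity of `W` in `κ`;
* currency out (`szpiro_window_of_log_window`): `(abc)² ≤ c⁶ ≤ exp(6K) · rad^(6+ε)`.

Elementary (`Real.log` / `Real.exp` bookkeeping, Mathlib's `UniqueFactorizationMonoid.radical` API);
no named facts, standard axioms. Sources: folklore polynomial identity `a(a+2b) + b² = (a+b)²`; the
descent is the crux-ideator's card `Summits/ABC/ABC/Cruxes/BalancedFreySzpiro/Ideas/balance-window-descent.md`.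
-/

-- `Summit.<Summit>.<Problem>` is the mandated summit-side namespace (CONVENTIONS §2); for the
-- single-conjunct summit `ABC` the two coincide, so the duplicate `ABC.ABC` is deliberate.
set_option linter.dupNamespace false

namespace Summit.ABC.ABC.Theorems

open Literature.NumberTheory.DiophantineGeometry
open Summit.ABC.ABC.Theses.CongruentialReceptacle
open UniqueFactorizationMonoid

/-! ### The squaring split `(a, b, c) ↦ (a(a+2b), b², c²)` -/

/-- The squaring split of an abc triple is an abc triple: `a(a+2b) + b² = (a+b)² = c²`, and
`gcd(a(a+2b), b²) = 1` because `gcd(a, b) = 1`. [folklore] -/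
theorem split_isABCTriple {a b c : ℕ} (h : IsABCTriple a b c) :
    IsABCTriple (a * (a + 2 * b)) (b ^ 2) (c ^ 2) := by
  obtain ⟨ha, hb, habc, hcop⟩ := h
  refine ⟨Nat.mul_pos ha (by omega), by positivity, ?_, ?_⟩
  · subst habc
    ring
  · have h1 : Nat.Coprime (a + 2 * b) b := (Nat.coprime_add_mul_right_left a b 2).mpr hcop
    exact Nat.Coprime.pow_right 2 (Nat.Coprime.mul_left hcop h1)

/-- Radical bound for the squaring split: `rad(a(a+2b) · b² · c²) ≤ (a + 2b) · rad(abc)`, since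
`a · b² · c²` divides `(abc)²` (same radical as `abc`) and `rad(a+2b) ≤ a+2b`. [folklore] -/
theorem rad_split_le {a b c : ℕ} (ha : a ≠ 0) (hb : b ≠ 0) (hc : c ≠ 0) :
    rad (a * (a + 2 * b)) (b ^ 2) (c ^ 2) ≤ (a + 2 * b) * rad a b c := by
  rw [rad_def, rad_def]
  have hY : a * b ^ 2 * c ^ 2 ∣ (a * b * c) ^ 2 := ⟨a, by ring⟩
  have hne : (a * b * c) ^ 2 ≠ 0 := by positivity
  have h1 : radical (a * b ^ 2 * c ^ 2) ∣ radical (a * b * c) := by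
    have h := radical_dvd_radical hY hne
    rwa [radical_pow _ two_ne_zero] at h
  have h2 : radical (a * (a + 2 * b) * b ^ 2 * c ^ 2) ∣
      radical (a + 2 * b) * radical (a * b ^ 2 * c ^ 2) := by
    have h : a * (a + 2 * b) * b ^ 2 * c ^ 2 = (a + 2 * b) * (a * b ^ 2 * c ^ 2) := by ring
    rw [h]
    exact radical_mul_dvd
  have h3 : radical (a + 2 * b) ≤ a + 2 * b := Nat.radical_le_self_iff.mpr (by omega)
  calc radical (a * (a + 2 * b) * b ^ 2 * c ^ 2)
      ≤ radical (a + 2 * b) * radical (a * b ^ 2 * c ^ 2) :=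
        Nat.le_of_dvd (Nat.mul_pos (Nat.radical_pos _) (Nat.radical_pos _)) h2
    _ ≤ (a + 2 * b) * radical (a * b * c) :=
        Nat.mul_le_mul h3 (Nat.le_of_dvd (Nat.radical_pos _) h1)

/-! ### One descent step in the logarithmic abc currency -/

/-- **Core of the descent step.** Assume the logarithmic abc bound `log C ≤ K' + (1+ε') log rad(ABC)`
on the window `κ₁` (`κ₁ ≤ 1/4`, `0 < ε' < 1`). If `(a, b, c)` is an abc triple with
`(2/3)κ₁c ≤ a < κ₁c`, then the squaring split `(a(a+2b), b², c²)` lies in the window `κ₁`, has radical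
`≤ 2c · rad(abc)`, and the bound there reads `2 log c ≤ K' + (1+ε')(log 2 + log c + log rad(abc))`, i.e.
`log c ≤ (K' + (1+ε') log 2)/(1-ε') + ((1+ε')/(1-ε')) · log rad(abc)`. [folklore] -/
theorem log_descent_core {κ₁ ε' K' : ℝ} (hκ₁ : 0 < κ₁) (hκ₁' : κ₁ ≤ 1 / 4) (hε' : 0 < ε')
    (hε'1 : ε' < 1)
    (H : ∀ a b c : ℕ, IsABCTriple a b c → κ₁ * (c : ℝ) ≤ (a : ℝ) → κ₁ * (c : ℝ) ≤ (b : ℝ) →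
      Real.log (c : ℝ) ≤ K' + (1 + ε') * Real.log ((rad a b c : ℕ) : ℝ))
    {a b c : ℕ} (h : IsABCTriple a b c) (ha : 2 / 3 * κ₁ * (c : ℝ) ≤ (a : ℝ))
    (ha' : (a : ℝ) < κ₁ * (c : ℝ)) :
    Real.log (c : ℝ) ≤ (K' + (1 + ε') * Real.log 2) / (1 - ε')
      + (1 + ε') / (1 - ε') * Real.log ((rad a b c : ℕ) : ℝ) := by
  obtain ⟨ha0, hb0, habc, hcop⟩ := h
  have hT : IsABCTriple (a * (a + 2 * b)) (b ^ 2) (c ^ 2) := split_isABCTriple ⟨ha0, hb0, habc, hcop⟩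
  have hc0' : c ≠ 0 := by omega
  have haR : (0 : ℝ) < a := by exact_mod_cast ha0
  have hbR : (0 : ℝ) < b := by exact_mod_cast hb0
  have hcR : (c : ℝ) = a + b := by exact_mod_cast habc.symm
  have hcpos : (0 : ℝ) < c := by rw [hcR]; exact add_pos haR hbR
  have hc0 : (0 : ℝ) ≤ c := hcpos.le
  have h14 : (a : ℝ) ≤ c / 4 := by
    have h := mul_le_mul_of_nonneg_right hκ₁' hc0
    linarith
  have hb34 : 3 / 4 * (c : ℝ) ≤ b := by linarith
  -- the split triple lies in the window `κ₁`
  have hA : κ₁ * ((c ^ 2 : ℕ) : ℝ) ≤ ((a * (a + 2 * b) : ℕ) : ℝ) := by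
    push_cast
    have hκc2 : 0 ≤ κ₁ * (c : ℝ) ^ 2 := by positivity
    calc κ₁ * (c : ℝ) ^ 2 ≤ 7 / 6 * κ₁ * (c : ℝ) ^ 2 := by nlinarith
      _ = (2 / 3 * κ₁ * c) * (7 / 4 * c) := by ring
      _ ≤ a * (7 / 4 * c) := mul_le_mul_of_nonneg_right ha (by positivity)
      _ ≤ a * (a + 2 * b) := mul_le_mul_of_nonneg_left (by linarith) haR.le
  have hB : κ₁ * ((c ^ 2 : ℕ) : ℝ) ≤ ((b ^ 2 : ℕ) : ℝ) := by
    push_cast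
    have h9 : (3 / 4 * (c : ℝ)) ^ 2 ≤ (b : ℝ) ^ 2 := pow_le_pow_left₀ (by positivity) hb34 2
    have h4 : κ₁ * (c : ℝ) ^ 2 ≤ 1 / 4 * (c : ℝ) ^ 2 := mul_le_mul_of_nonneg_right hκ₁' (by positivity)
    nlinarith
  have hmain := H _ _ _ hT hA hB
  -- radicals
  have hr0 : 0 < rad a b c := Nat.radical_pos _
  have hrpos : (0 : ℝ) < ((rad a b c : ℕ) : ℝ) := by exact_mod_cast hr0
  have hrS0 : 0 < rad (a * (a + 2 * b)) (b ^ 2) (c ^ 2) := Nat.radical_pos _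
  have hrSpos : (0 : ℝ) < ((rad (a * (a + 2 * b)) (b ^ 2) (c ^ 2) : ℕ) : ℝ) := by exact_mod_cast hrS0
  have hradle : ((rad (a * (a + 2 * b)) (b ^ 2) (c ^ 2) : ℕ) : ℝ) ≤ 2 * c * ((rad a b c : ℕ) : ℝ) := by
    have h1 : rad (a * (a + 2 * b)) (b ^ 2) (c ^ 2) ≤ (a + 2 * b) * rad a b c :=
      rad_split_le ha0.ne' hb0.ne' hc0'
    have h2 : ((rad (a * (a + 2 * b)) (b ^ 2) (c ^ 2) : ℕ) : ℝ)
        ≤ ((a + 2 * b : ℕ) : ℝ) * ((rad a b c : ℕ) : ℝ) := by exact_mod_cast h1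
    have h3 : ((a + 2 * b : ℕ) : ℝ) ≤ 2 * c := by push_cast; linarith
    exact h2.trans (mul_le_mul_of_nonneg_right h3 hrpos.le)
  have hlogS : Real.log ((rad (a * (a + 2 * b)) (b ^ 2) (c ^ 2) : ℕ) : ℝ)
      ≤ Real.log 2 + Real.log c + Real.log ((rad a b c : ℕ) : ℝ) := by
    have h := Real.log_le_log hrSpos hradle
    rwa [Real.log_mul (by positivity) hrpos.ne', Real.log_mul (by norm_num) hcpos.ne'] at h
  have hlogc2 : Real.log ((c ^ 2 : ℕ) : ℝ) = 2 * Real.log c := by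
    push_cast
    rw [Real.log_pow]
    norm_num
  rw [hlogc2] at hmain
  -- final linear algebra
  have h1ε : 0 < 1 - ε' := by linarith
  have hε1 : 0 ≤ 1 + ε' := by linarith
  have hkey := mul_le_mul_of_nonneg_left hlogS hε1
  rw [div_mul_eq_mul_div, ← add_div, le_div_iff₀ h1ε]
  linarith

/-! ### Currency exchange at both ends -/

/-- **Currency in.** On the window `κ = 1/4`, Szpiro's bound `(abc)² ≤ C · rad^(6+ε)` gives the
logarithmic abc bound `log c ≤ (log max(C,1) + 4 log 4)/6 + (1+ε) · log rad(abc)`, because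
`(1/4)⁴ c⁶ ≤ (abc)²` there and `log rad ≥ 0`. [folklore] -/
theorem log_window_of_szpiro_window {C ε : ℝ} {a b c : ℕ} (h : IsABCTriple a b c)
    (ha : (1 / 4 : ℝ) * (c : ℝ) ≤ (a : ℝ)) (hb : (1 / 4 : ℝ) * (c : ℝ) ≤ (b : ℝ)) (hε : 0 < ε)
    (hS : ((a * b * c : ℕ) : ℝ) ^ 2 ≤ C * ((rad a b c : ℕ) : ℝ) ^ (6 + ε)) :
    Real.log (c : ℝ) ≤ (Real.log (max C 1) + 4 * Real.log 4) / 6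
      + (1 + ε) * Real.log ((rad a b c : ℕ) : ℝ) := by
  obtain ⟨ha0, -, habc, -⟩ := h
  have hcpos : (0 : ℝ) < c := by
    have h0 : 0 < c := by omega
    exact_mod_cast h0
  have hr0 : 0 < rad a b c := Nat.radical_pos _
  have hrpos : (0 : ℝ) < ((rad a b c : ℕ) : ℝ) := by exact_mod_cast hr0
  have hR0 : 0 ≤ Real.log ((rad a b c : ℕ) : ℝ) :=
    Real.log_nonneg (by exact_mod_cast Nat.one_le_iff_ne_zero.mpr hr0.ne')
  have hMpos : (0 : ℝ) < max C 1 := lt_of_lt_of_le one_pos (le_max_right _ _)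
  have hlow : (1 / 4 : ℝ) ^ 4 * (c : ℝ) ^ 6 ≤ ((a * b * c : ℕ) : ℝ) ^ 2 :=
    balanced_pow_six_le (by norm_num) ha hb
  have hM : C * ((rad a b c : ℕ) : ℝ) ^ (6 + ε) ≤ max C 1 * ((rad a b c : ℕ) : ℝ) ^ (6 + ε) :=
    mul_le_mul_of_nonneg_right (le_max_left _ _) (Real.rpow_nonneg hrpos.le _)
  have hchain := hlow.trans (hS.trans hM)
  have hlog := Real.log_le_log (by positivity) hchain
  rw [Real.log_mul (by positivity) (by positivity), Real.log_pow, Real.log_pow,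
    Real.log_mul hMpos.ne' (Real.rpow_pos_of_pos hrpos _).ne', Real.log_rpow hrpos] at hlog
  have hl4 : Real.log (1 / 4 : ℝ) = -Real.log 4 := by
    rw [one_div, Real.log_inv]
  rw [hl4] at hlog
  push_cast at hlog
  have hslope : (1 + ε / 6) * Real.log ((rad a b c : ℕ) : ℝ) ≤ (1 + ε) * Real.log ((rad a b c : ℕ) : ℝ) :=
    mul_le_mul_of_nonneg_right (by linarith) hR0
  linarith

/-- **Currency out.** The logarithmic abc bound `log c ≤ K + (1 + ε/6) · log rad(abc)` gives Szpiro's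
bound `(abc)² ≤ exp(6K) · rad^(6+ε)`, because `(abc)² ≤ c⁶` for an abc triple. [folklore] -/
theorem szpiro_window_of_log_window {K ε : ℝ} {a b c : ℕ} (h : IsABCTriple a b c)
    (hL : Real.log (c : ℝ) ≤ K + (1 + ε / 6) * Real.log ((rad a b c : ℕ) : ℝ)) :
    ((a * b * c : ℕ) : ℝ) ^ 2 ≤ Real.exp (6 * K) * ((rad a b c : ℕ) : ℝ) ^ (6 + ε) := by
  obtain ⟨ha0, -, habc, -⟩ := h
  have hac : a ≤ c := by omega
  have hbc : b ≤ c := by omega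
  have hcpos : (0 : ℝ) < c := by
    have h0 : 0 < c := by omega
    exact_mod_cast h0
  have hr0 : 0 < rad a b c := Nat.radical_pos _
  have hrpos : (0 : ℝ) < ((rad a b c : ℕ) : ℝ) := by exact_mod_cast hr0
  have h3 : ((a * b * c : ℕ) : ℝ) ≤ (c : ℝ) ^ 3 := by
    have h1 : a * b * c ≤ c * c * c := Nat.mul_le_mul (Nat.mul_le_mul hac hbc) le_rfl
    calc ((a * b * c : ℕ) : ℝ) ≤ ((c * c * c : ℕ) : ℝ) := by exact_mod_cast h1
      _ = (c : ℝ) ^ 3 := by push_cast; ring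
  have h6 : ((a * b * c : ℕ) : ℝ) ^ 2 ≤ (c : ℝ) ^ 6 := by
    calc ((a * b * c : ℕ) : ℝ) ^ 2 ≤ ((c : ℝ) ^ 3) ^ 2 := pow_le_pow_left₀ (by positivity) h3 2
      _ = (c : ℝ) ^ 6 := by ring
  have hc1 : (c : ℝ) ≤ Real.exp (K + (1 + ε / 6) * Real.log ((rad a b c : ℕ) : ℝ)) := by
    calc (c : ℝ) = Real.exp (Real.log c) := (Real.exp_log hcpos).symm
      _ ≤ _ := Real.exp_le_exp.mpr hL
  have hc6 : (c : ℝ) ^ 6 ≤ Real.exp (6 * K) * ((rad a b c : ℕ) : ℝ) ^ (6 + ε) := by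
    calc (c : ℝ) ^ 6 ≤ (Real.exp (K + (1 + ε / 6) * Real.log ((rad a b c : ℕ) : ℝ))) ^ 6 :=
          pow_le_pow_left₀ hcpos.le hc1 6
      _ = Real.exp (6 * K) * ((rad a b c : ℕ) : ℝ) ^ (6 + ε) := by
          rw [← Real.exp_nat_mul, Real.rpow_def_of_pos hrpos, ← Real.exp_add]
          congr 1
          push_cast
          ring
  exact h6.trans hc6

/-! ### The item -/

/-- **Item stmt-ABC-15117 (`QuarterWindowGivesCrux`) of route CongruentialReceptacle, proved.**
Szpiro's `6 + ε` in elementary currency for abc triples on the single balance window `c/4 ≤ a`,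
`c/4 ≤ b` implies it on every window `κc ≤ a`, `κc ≤ b` (`κ > 0`), i.e. the crux `BalancedFreySzpiro`:
the quantifier over `κ` in the crux is spurious. Proof: pass to the logarithmic abc currency
(`log_window_of_szpiro_window`), descend from window `κ₁ ≤ 1/4` to window `(2/3)κ₁` by the squaring
split (`log_descent_core`, both orientations), iterate along `κₙ = ¼(2/3)ⁿ → 0`, and return to the
product currency (`szpiro_window_of_log_window`). Unconditional; no named facts. [folklore] -/
theorem quarterWindowGivesCrux_proof :
    (∀ ε : ℝ, 0 < ε → ∃ C : ℝ, ∀ a b c : ℕ, Literature.NumberTheory.DiophantineGeometry.IsABCTriple a b c → (1 / 4 : ℝ) * (c : ℝ) ≤ (a : ℝ) → (1 / 4 : ℝ) * (c : ℝ) ≤ (b : ℝ) → ((a * b * c : ℕ) : ℝ) ^ 2 ≤ C * ((Literature.NumberTheory.DiophantineGeometry.rad a b c : ℕ) : ℝ) ^ (6 + ε)) → BalancedFreySzpiro := by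
  intro H
  unfold Summit.ABC.ABC.Theses.CongruentialReceptacle.BalancedFreySzpiro
  intro κ hκ ε hε
  -- the logarithmic window predicate `W`
  obtain ⟨W, hW⟩ : ∃ W : ℝ → Prop, ∀ κ : ℝ, W κ ↔
      ∀ ε : ℝ, 0 < ε → ∃ K : ℝ, 0 ≤ K ∧ ∀ a b c : ℕ, IsABCTriple a b c →
        κ * (c : ℝ) ≤ (a : ℝ) → κ * (c : ℝ) ≤ (b : ℝ) →
          Real.log (c : ℝ) ≤ K + (1 + ε) * Real.log ((rad a b c : ℕ) : ℝ) :=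
    ⟨_, fun _ => Iff.rfl⟩
  have hlog2 : 0 ≤ Real.log 2 := Real.log_nonneg one_le_two
  -- currency in: `W (1/4)` from the hypothesis
  have h14 : W (1 / 4) := by
    rw [hW]
    intro δ hδ
    obtain ⟨C, hC⟩ := H δ hδ
    refine ⟨(Real.log (max C 1) + 4 * Real.log 4) / 6, ?_, ?_⟩
    · have h1 : 0 ≤ Real.log (max C 1) := Real.log_nonneg (le_max_right _ _)
      have h2 : 0 ≤ Real.log 4 := Real.log_nonneg (by norm_num)
      positivity
    · intro a b c h ha hb
      exact log_window_of_szpiro_window h ha hb hδ (hC a b c h ha hb)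
  -- monotonicity of `W` in `κ`
  have hmono : ∀ κ κ' : ℝ, κ ≤ κ' → W κ → W κ' := by
    intro κ κ' hle hWκ
    rw [hW] at hWκ ⊢
    intro δ hδ
    obtain ⟨K, hK0, hK⟩ := hWκ δ hδ
    refine ⟨K, hK0, fun a b c h ha hb => hK a b c h ?_ ?_⟩
    · exact (mul_le_mul_of_nonneg_right hle (Nat.cast_nonneg c)).trans ha
    · exact (mul_le_mul_of_nonneg_right hle (Nat.cast_nonneg c)).trans hb
  -- one descent step `W κ₁ → W ((2/3) κ₁)` for `0 < κ₁ ≤ 1/4`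
  have hstep : ∀ κ₁ : ℝ, 0 < κ₁ → κ₁ ≤ 1 / 4 → W κ₁ → W (2 / 3 * κ₁) := by
    intro κ₁ hκ₁ hκ₁' hW1
    rw [hW] at hW1 ⊢
    intro δ hδ
    have h2δ : (2 : ℝ) + δ ≠ 0 := by positivity
    have hδ' : 0 < δ / (2 + δ) := by positivity
    have hδ'1 : δ / (2 + δ) < 1 := by
      rw [div_lt_one (by positivity)]
      linarith
    have hδ'le : δ / (2 + δ) ≤ δ := div_le_self hδ.le (by linarith)
    have h1m : 0 < 1 - δ / (2 + δ) := by linarith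
    have hε1 : 0 ≤ 1 + δ / (2 + δ) := by linarith
    have hratio : (1 + δ / (2 + δ)) / (1 - δ / (2 + δ)) = 1 + δ := by
      rw [div_eq_iff h1m.ne']
      field_simp
      ring
    obtain ⟨K', hK'0, hK'⟩ := hW1 (δ / (2 + δ)) hδ'
    refine ⟨(K' + (1 + δ / (2 + δ)) * Real.log 2) / (1 - δ / (2 + δ)), ?_, ?_⟩
    · exact div_nonneg (add_nonneg hK'0 (mul_nonneg hε1 hlog2)) h1m.le
    · intro a b c h ha hb
      by_cases hA : κ₁ * (c : ℝ) ≤ a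
      · by_cases hB : κ₁ * (c : ℝ) ≤ b
        · -- the triple already lies in the window `κ₁`
          have h0 := hK' a b c h hA hB
          have hR0 : 0 ≤ Real.log ((rad a b c : ℕ) : ℝ) :=
            Real.log_nonneg (by exact_mod_cast Nat.one_le_iff_ne_zero.mpr (Nat.radical_pos _).ne')
          have hKK : K' ≤ (K' + (1 + δ / (2 + δ)) * Real.log 2) / (1 - δ / (2 + δ)) := by
            rw [le_div_iff₀ h1m]
            nlinarith [mul_nonneg hK'0 hδ'.le, mul_nonneg hε1 hlog2]
          have hslope : (1 + δ / (2 + δ)) * Real.log ((rad a b c : ℕ) : ℝ)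
              ≤ (1 + δ) * Real.log ((rad a b c : ℕ) : ℝ) :=
            mul_le_mul_of_nonneg_right (by linarith) hR0
          linarith
        · -- `b < κ₁ c`: split the swapped triple
          have hcore := log_descent_core hκ₁ hκ₁' hδ' hδ'1 hK' h.swap hb (not_le.mp hB)
          rw [rad_swap a b c, hratio] at hcore
          exact hcore
      · -- `a < κ₁ c`: split the triple
        have hcore := log_descent_core hκ₁ hκ₁' hδ' hδ'1 hK' h ha (not_le.mp hA)
        rw [hratio] at hcore
        exact hcore
  -- iterate along `κₙ = ¼ (2/3)ⁿ`
  have hiter : ∀ n : ℕ, W (1 / 4 * (2 / 3) ^ n) := by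
    intro n
    induction n with
    | zero => exact hmono _ _ (by norm_num) h14
    | succ n ih =>
      have hle : 1 / 4 * (2 / 3 : ℝ) ^ n ≤ 1 / 4 :=
        mul_le_of_le_one_right (by norm_num) (pow_le_one₀ (by norm_num) (by norm_num))
      have h := hstep _ (by positivity) hle ih
      exact hmono _ _ (le_of_eq (by ring)) h
  -- reach the requested window `κ`
  obtain ⟨n, hn⟩ := exists_pow_lt_of_lt_one (by positivity : (0 : ℝ) < 4 * κ)
    (by norm_num : (2 / 3 : ℝ) < 1)
  have hWκ : W κ := hmono _ _ (by linarith) (hiter n)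
  -- currency out
  rw [hW] at hWκ
  obtain ⟨K, -, hK⟩ := hWκ (ε / 6) (by positivity)
  exact ⟨Real.exp (6 * K), fun a b c h ha hb => szpiro_window_of_log_window h (hK a b c h ha hb)⟩

end Summit.ABC.ABC.Theorems

-- The item's ledger signature names the crux by its route-local short name `BalancedFreySzpiro`;
-- keeping the route namespace open at top level lets that signature elaborate verbatim in the
-- context of this file (the gate's statement probes are appended here). No declarations follow.
open Summit.ABC.ABC.Theses.CongruentialReceptacle

-- Root-level alias `BalancedFreySzpiro ↦ Summit.ABC.ABC.Theses.CongruentialReceptacle.BalancedFreySzpiro`, so that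
-- the item's ledger signature (which names the crux by this short name) also elaborates in any scratch module that
-- merely IMPORTS this one (the gate's `statement-close` term probe). The alias points at the same constant as the
-- route-namespace name, so `open Summit.ABC.ABC.Theses.CongruentialReceptacle` in an importer stays unambiguous;
-- it is the only declaration of that name in the tree (2026-08-16).
export Summit.ABC.ABC.Theses.CongruentialReceptacle (BalancedFreySzpiro)
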